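import Summits.ResolutionOfSingularities.ResolutionOfSingularities.Theorems.RadicialJungCleanResolvesRegularType
import Summits.ResolutionOfSingularities.ResolutionOfSingularities.Theorems.RadicialJungCleanResolvesStalks

/-!
# Route `RadicialJung`, support `CleanResolves`: `V^L` is regular over regular-type clean points

Route `ResolutionOfSingularities/RadicialJung`, support item `CleanResolves`
(stmt-ResolutionOfSingularities-16286). Assembly of the two previous helper files into the statement
the item's plan calls "at a regular-type point `V^L` is regular", in the exact local hypotheses of
`CleanResolves` (after `cleanResolves_of_self`): `V` integral with function field `K` of
characteristic `p`, `L/K` of degree `p`, `v'` a point of `V^L = normalizationIn V L` over `v`,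
`𝒪_{V,v}` regular, and a generator `y ∈ L ∖ K` with `y^p = u₀ ∈ 𝒪_{V,v}` of REGULAR TYPE —
`∀ c, u₀ - c^p ∉ 𝔪_v` (wound) or `∃ c, u₀ - c^p ∈ 𝔪_v ∖ 𝔪_v²` (transversal). Then `𝒪_{V^L,v'}` is
a regular local ring: it is the integral closure of `𝒪_{V,v}` in `L`
(`RadicialJungCleanResolvesStalks`), which is the regular order `𝒪_{V,v}[T]/(T^p - u₀)`
(`RadicialJungCleanResolvesRegularType`, from `PicoverLocalModel.WoundExit/TransversalExit`).
-/

noncomputable section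

set_option linter.dupNamespace false -- mandated namespace of this single-conjunct summit

open CategoryTheory AlgebraicGeometry
open Literature.AlgebraicGeometry.Resolution

namespace Summit.ResolutionOfSingularities.ResolutionOfSingularities.Theorems.RadicialJung.CleanResolves

universe u

/-- **`V^L` is regular over a regular-type clean point.** Let `V` be an integral scheme whose
function field `K` has characteristic `p` (prime), `L/K` an extension of degree `p`, `v'` a point
of `V^L = normalizationIn V L` lying over `v ∈ V` with `𝒪_{V,v}` a regular local ring, and
`y ∈ L ∖ K`, `u₀ ∈ 𝒪_{V,v}` with `y^p = u₀` such that either `u₀ - c^p ∉ 𝔪_v` for all `c` (wound)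
or `u₀ - c^p ∈ 𝔪_v ∖ 𝔪_v²` for some `c` (transversal). Then the local ring `𝒪_{V^L,v'}` is regular.
[folklore] -/
theorem isRegularLocalRing_stalk_normalizationIn_of_regularType {p : ℕ} (hp : p.Prime)
    (V : Scheme.{u}) [IsIntegral V] [CharP V.functionField p] (L : Type u) [Field L]
    [Algebra V.functionField L] [FiniteDimensional V.functionField L]
    (hdeg : Module.finrank V.functionField L = p) (v' : normalizationIn V L)
    (hv : IsRegularLocalRing (V.presheaf.stalk (normalizationInι V L v'))) (y : L)
    (u₀ : V.presheaf.stalk (normalizationInι V L v'))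
    (hy : y ∉ Set.range (algebraMap V.functionField L))
    (hyp : algebraMap V.functionField L
      (algebraMap (V.presheaf.stalk (normalizationInι V L v')) V.functionField u₀) = y ^ p)
    (hu : (∀ c : V.presheaf.stalk (normalizationInι V L v'),
        u₀ - c ^ p ∉ IsLocalRing.maximalIdeal (V.presheaf.stalk (normalizationInι V L v'))) ∨
      (∃ c : V.presheaf.stalk (normalizationInι V L v'),
        u₀ - c ^ p ∈ IsLocalRing.maximalIdeal (V.presheaf.stalk (normalizationInι V L v')) ∧
        u₀ - c ^ p ∉ IsLocalRing.maximalIdeal (V.presheaf.stalk (normalizationInι V L v')) ^ 2)) :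
    IsRegularLocalRing ((normalizationIn V L).presheaf.stalk v') := by
  letI : Algebra (V.presheaf.stalk (normalizationInι V L v')) L :=
    ((algebraMap V.functionField L).comp
      (algebraMap (V.presheaf.stalk (normalizationInι V L v')) V.functionField)).toAlgebra
  haveI : IsScalarTower (V.presheaf.stalk (normalizationInι V L v')) V.functionField L :=
    IsScalarTower.of_algebraMap_eq fun _ => rfl
  haveI := hv
  haveI : CharP (V.presheaf.stalk (normalizationInι V L v')) p :=
    RingHom.charP (algebraMap (V.presheaf.stalk (normalizationInι V L v')) V.functionField)
      (IsFractionRing.injective _ _) p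
  haveI : CharP L p := charP_of_injective_ringHom (algebraMap V.functionField L).injective p
  have hyp' : y ^ p = algebraMap (V.presheaf.stalk (normalizationInι V L v')) L u₀ := hyp.symm
  haveI : IsRegularLocalRing (integralClosure (V.presheaf.stalk (normalizationInι V L v')) L) := by
    rcases hu with hw | ⟨c, hc1, hc2⟩
    · exact isRegularLocalRing_integralClosure_of_wound (K := V.functionField) hp hdeg u₀ y hy hyp' hw
    · exact isRegularLocalRing_integralClosure_of_transversal (K := V.functionField) hp hdeg u₀ y hy
        hyp' c hc1 hc2
  exact isRegularLocalRing_stalk_normalizationIn V L v'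

end Summit.ResolutionOfSingularities.ResolutionOfSingularities.Theorems.RadicialJung.CleanResolves

end
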